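import Literature.AnabelianGeometry.EtaleTheta.Discharge.Sec3Prop34CnstOfRlfR
import Literature.AnabelianGeometry.EtaleTheta.RealSpanPrimeCoordinates
import Literature.Analysis.Convex.RationalConeRealSpan
import Literature.AnabelianGeometry.EtaleTheta.PerfectionPrimes
import Literature.AlgebraicGeometry.Frobenioids.PerfectionPrimes
import HarnessLib

/-!
# [EtTh] Prop 3.4 (ii) / Def 3.6 (i), `Λ = ℝ`: the effective locus of `B₀^ℝ = ℝ·Φ₀^birat` IS constant when
# `Φ₀(Y)` has finitely many primes, all of them `ℚ`-primes (a rational polyhedral cone argument)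

Proof-only companion (theorems only) in the series `Discharge/Sec3*.lean`, cell abc-iut, sub-DAG
`plan/L2/SUBDAG-EtTh-Thm37.md`, row «EtTh:Thm3.7(iii)/L10-R-fin» (GAP-LEDGER G-w5d130-1 (b)).  S. Mochizuki, *The étale
theta function …*, Publ. RIMS **45** (2009) [EtTh], §3, Prop. 3.4 (ii) p.74, Def. 3.6 (i) p.76, Thm. 3.7 (iii) p.79 and
Remark 3.3.1 p.73 (PDF) [cite: MochizukiEtTh2009, Prop 3.4 (ii) p.74]: "the set of primes of … `Φ₀(Y^log)` is in natural
bijective correspondence with the set of `Gal(Z^log_∞/Y^log)`-orbits of prime log-divisors on `Z^log_∞`" (finitely many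
for a covering with finitely many irreducible components in its special fibre; each `M_𝔭 ≅ ℤ_{≥0}`, so `M^pf_𝔭 ≅ ℚ_{≥0}`).

The `Λ = ℝ` effective-locus clause `hE` of `RealifiedDivisorMonoids.Prop34Cnst (ofRlfR dm hpf) cnst` ("an element of
`ℝ·Φ₀^birat(Y)` with effective image in `(Φ₀^rlf)^gp(Y)` lies in `ℝ·Φ₀^cnst(Y)`") is NOT a formal consequence of the
`B₀`-level Prop. 3.4 (ii) over arbitrary perf-factorial data (`Sec3Prop34CnstOfRlfRNegative.lean`: three `ℝ`-primes).
THIS FILE proves it from `DivisorMonoids.Prop34.mem_F₀_of_div₀_mem` ("a log-meromorphic function with effective divisor is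
constant") under the hypothesis that `Φ₀(Y)` has FINITELY many primes and every `M^pf_𝔮` is `ℚ`-monoprime
(`eff_of_finite_ratPrimes`), hence `Prop34Cnst (ofRlfR dm hpf) cnst` and Theorem 3.7 (iii) for the constructed `Λ = ℝ`
data under that hypothesis at every `Y` (`ofRlfR_of_finite_ratPrimes`, `TemperedFrobenioid.thm37_iii_withCnst_ofRlfR_fin`).
Proof: write `b = Σ_k r_k · ι(div₀ g_k)`; in the prime coordinates of `(Φ₀^rlf)^gp(Y)` (`RealSpanPrimeCoordinates.lean`)
effectivity of a real combination is a finite system of RATIONAL linear inequalities in `r` (the coordinates of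
`ι(div₀ g)` are rational up to one positive constant per prime), so `r` is a real combination of rational solutions
(`RationalCone.mem_span_ratCast_of_forall_sum_mul_nonneg`, `Literature/Analysis/Convex/RationalConeRealSpan.lean`); a
rational solution `q = z/N` gives the function `g_q = ∏ g_k^{z_k}` with EFFECTIVE divisor, constant by Prop. 3.4 (ii), and
`Σ_k q_k · ι(div₀ g_k) = (1/N) · ι(div₀ g_q) ∈ ℝ·Φ₀^cnst`; `ℝ·Φ₀^cnst` is stable under real combinations.
HONEST FRAMING: refereed pre-IUT material; nothing here bears on [IUTchIII] Cor. 3.12; no statement of print is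
strengthened (the hypothesis is print's situation for finite coverings; for `Ÿ`-type objects with infinitely many
components the clause remains the named hypothesis `hE` of `Sec3Prop34CnstOfRlfR.lean`).
-/

noncomputable section

namespace Literature.AnabelianGeometry.EtaleTheta

open CategoryTheory Opposite Literature.AlgebraicGeometry.Frobenioids NNReal

universe u₀ v₀ u₁ v₁ u v w

/-! ### Two arithmetic helpers -/

/-- `z • x = x^z` for the `ℝ`-action of a realification datum and `z ∈ ℤ`. [cite: MochizukiFrdI2008, Def. 2.4(i) p.48] -/
private theorem rsmul_intCast {D : Type u} [Category.{v} D] {Φ : Dᵒᵖ ⥤ CommMonCat.{w}} (R : RealificationData Φ)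
    (X : D) (z : ℤ) (x : Algebra.GrothendieckGroup (R.rlf.obj (op X))) : R.rsmul X (z : ℝ) x = x ^ z := by
  cases z with
  | ofNat n => rw [Int.ofNat_eq_natCast, Int.cast_natCast, R.rsmul_natCast, zpow_natCast]
  | negSucc n => rw [Int.cast_negSucc, RealificationDataLemmas.rsmul_neg', R.rsmul_natCast, zpow_negSucc]

/-- Clearing denominators: finitely many rationals are `z_k / N` with one `N ≥ 1`. [folklore] -/
private theorem exists_int_eq_nat_mul {n : ℕ} (q : Fin n → ℚ) :
    ∃ N : ℕ, 0 < N ∧ ∃ z : Fin n → ℤ, ∀ k, (z k : ℚ) = (N : ℚ) * q k := by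
  classical
  refine ⟨∏ k, (q k).den, Finset.prod_pos fun k _ => (q k).den_pos,
    fun k => (∏ j ∈ Finset.univ.erase k, ((q j).den : ℤ)) * (q k).num, fun k => ?_⟩
  rw [← Finset.prod_erase_mul _ _ (Finset.mem_univ k)]
  push_cast
  rw [mul_assoc, Rat.den_mul_eq_num]

namespace RealifiedDivisorMonoids.Prop34Cnst

variable {D₀ : Type u} [Category.{v} D₀] {dm : DivisorMonoids.{u, v, w} D₀}
  {hpf : ∀ Y : D₀ᵒᵖ, IsPerfFactorial (dm.Φ₀.obj Y)} {V : FrdIMonoidStub.{w}} {V₀ : FrdICatStub.{u, v, w} D₀}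
  {Dcnst : Type u₁} [Category.{v₁} Dcnst] {cnst : D₀ ⥤ Dcnst}

/-- `Φ₀^birat(Y)` is already a group (`B₀(Y)` consists of units), so every element of the subgroup it generates is
a divisor `div₀ g`. [cite: MochizukiEtTh2009, Def 3.3 p.73] -/
theorem exists_div₀_eq_of_mem_biratGp (Y : D₀) {c : Algebra.GrothendieckGroup (dm.Φ₀.obj (op Y))}
    (hc : c ∈ dm.biratGp.carrier Y) : ∃ g : dm.B₀.obj (op Y), dm.div₀ (op Y) g = c := by
  let K : Subgroup (Algebra.GrothendieckGroup (dm.Φ₀.obj (op Y))) :=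
    { carrier := Set.range (dm.div₀ (op Y))
      mul_mem' := by
        rintro _ _ ⟨g, rfl⟩ ⟨g', rfl⟩
        exact ⟨g * g', map_mul _ _ _⟩
      one_mem' := ⟨1, map_one _⟩
      inv_mem' := by
        rintro _ ⟨g, rfl⟩
        refine ⟨((dm.isUnit_B₀ _ g).unit⁻¹ : (dm.B₀.obj (op Y))ˣ), ?_⟩
        rw [eq_inv_iff_mul_eq_one, ← map_mul, IsUnit.val_inv_mul, map_one] }
  have hle : dm.biratGp.carrier Y ≤ K := (Subgroup.closure_le K).mpr (by rintro _ ⟨g, rfl⟩; exact ⟨g, rfl⟩)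
  exact hle hc

/-- A fraction presentation in `Φ₀(Y)^gp`. [folklore] -/
private theorem exists_eq_of_div_of {N : Type w} [CommMonoid N] (ξ : Algebra.GrothendieckGroup N) :
    ∃ a b : N, ξ = Algebra.GrothendieckGroup.of a / Algebra.GrothendieckGroup.of b := by
  obtain ⟨⟨a, b⟩, hx⟩ := (Localization.monoidOf (⊤ : Submonoid N)).surj ξ
  exact ⟨a, b, eq_div_iff_mul_eq'.mpr hx⟩

/-- **The `Λ = ℝ` effective-locus clause for `Φ₀(Y)` with finitely many primes, all `ℚ`-primes**: an element `b` of
`ℝ·Φ₀^birat(Y)` whose image in `(Φ₀^rlf)^gp(Y)` is the class of an element of `Φ₀(Y)^rlf` lies in `ℝ·Φ₀^cnst(Y)` — from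
Prop. 3.4 (ii) at the `B₀`-level ("a function with effective divisor is constant") by the rational-polyhedral-cone
argument of the module docstring. [cite: MochizukiEtTh2009, Prop 3.4 (ii) p.74] -/
theorem eff_of_finite_ratPrimes (h34 : dm.Prop34 V V₀) (Y : D₀)
    [Finite (Primes (Perfection (dm.Φ₀.obj (op Y))))]
    (hQ : ∀ 𝔮 : Primes (Perfection (dm.Φ₀.obj (op Y))), IsQMonoprime (PfAt (dm.Φ₀.obj (op Y)) 𝔮))
    (b : Algebra.GrothendieckGroup ((realData dm hpf).rlf.obj (op Y))) (x : (hpf (op Y)).Rlf)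
    (hb : b ∈ ((realData dm hpf).realSpan dm.biratGp).carrier Y) (hbx : b = Algebra.GrothendieckGroup.of x) :
    b ∈ ((realData dm hpf).realSpan dm.cnstGp).carrier Y := by
  classical
  -- S0: coordinates `f 𝔮` of the completions `M^rlf_𝔮` (all `ℚ`-primes) and their rationality constants on `M^pf`
  have hf : ∀ 𝔮 : Primes (Perfection (dm.Φ₀.obj (op Y))),
      Nonempty (RlfAt (dm.Φ₀.obj (op Y)) 𝔮 ≃* Multiplicative ℝ≥0) :=
    fun 𝔮 => RealificationCoord.nonempty_coord (IsMonoprime.ofQ (hQ 𝔮))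
  let f : ∀ 𝔮, RlfAt (dm.Φ₀.obj (op Y)) 𝔮 ≃* Multiplicative ℝ≥0 := fun 𝔮 => (hf 𝔮).some
  have hc : ∀ 𝔮, ∃ c : ℝ≥0, c ≠ 0 ∧ ∀ a, ∃ q : ℚ≥0,
      Multiplicative.toAdd (PrimeCoord.coord (hpf (op Y)) 𝔮 (f 𝔮) ((hpf (op Y)).toRealification a)) = c * (q : ℝ≥0) :=
    fun 𝔮 => PrimeCoord.exists_nnrat_coord_toRealification 𝔮 (hQ 𝔮) (f 𝔮)
  choose cst hcst0 hcq using hc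
  choose qa hqa using hcq
  -- S1: `b = ∏_k r_k • ι(div₀ g_k)` with `g_k ∈ B₀(Y)`
  obtain ⟨n, r, cvec, hcvec, rfl⟩ :=
    RealificationDataLemmas.exists_prod_rsmul_of_mem_realSpan (realData dm hpf) dm.biratGp Y hb
  have hg' : ∀ k, ∃ g : dm.B₀.obj (op Y), dm.div₀ (op Y) g = cvec k :=
    fun k => exists_div₀_eq_of_mem_biratGp Y (hcvec k)
  choose g hg using hg'
  simp only [← hg] at hbx ⊢
  -- S2: `div₀ g_k = [m_k]/[m'_k]`; the rational coordinates `A 𝔮 k`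
  have hmm : ∀ k, ∃ m m' : dm.Φ₀.obj (op Y),
      dm.div₀ (op Y) (g k) = Algebra.GrothendieckGroup.of m / Algebra.GrothendieckGroup.of m' :=
    fun k => exists_eq_of_div_of _
  choose m m' hm using hmm
  let A : Primes (Perfection (dm.Φ₀.obj (op Y))) → Fin n → ℚ := fun 𝔮 k =>
    (qa 𝔮 (Perfection.of _ (m k)) : ℚ) - qa 𝔮 (Perfection.of _ (m' k))
  -- the same elements read in `(M^rlf)^gp` for `M := Φ₀(Y)` (the home of the prime coordinates)
  set ιg : Algebra.GrothendieckGroup (dm.Φ₀.obj (op Y)) →* Algebra.GrothendieckGroup (hpf (op Y)).Rlf :=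
    MonGp.map ((hpf (op Y)).toRealification.comp (Perfection.of _)) with hιg
  have hP : ∀ v : Fin n → ℝ, (∏ k, (realData dm hpf).rsmul Y (v k) ((realData dm hpf).toRlfGp Y (dm.div₀ (op Y) (g k)))) =
      ∏ k, IsPerfFactorial.Rlf.realSMul (hpf (op Y)) (v k) (ιg (dm.div₀ (op Y) (g k))) := fun v => rfl
  -- coordinates: `coordGp 𝔮 (∏_k v_k • ι(div₀ g_k)) = cst 𝔮 · Σ_k A 𝔮 k · v k`
  have hco : ∀ (𝔮) (mm : dm.Φ₀.obj (op Y)), Multiplicative.toAdd (PrimeCoord.coordGp (hpf (op Y)) 𝔮 (f 𝔮)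
      (ιg (Algebra.GrothendieckGroup.of mm))) = (cst 𝔮 : ℝ) * ((qa 𝔮 (Perfection.of _ mm) : ℚ≥0) : ℝ) := by
    intro 𝔮 mm
    rw [hιg, MonGp.map_of, PrimeCoord.toAdd_coordGp_of, MonoidHom.comp_apply, hqa, NNReal.coe_mul]
    rfl
  have hL : ∀ (𝔮) (v : Fin n → ℝ), Multiplicative.toAdd (PrimeCoord.coordGp (hpf (op Y)) 𝔮 (f 𝔮)
      (∏ k, IsPerfFactorial.Rlf.realSMul (hpf (op Y)) (v k) (ιg (dm.div₀ (op Y) (g k))))) =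
        (cst 𝔮 : ℝ) * ∑ k, (A 𝔮 k : ℝ) * v k := by
    intro 𝔮 v
    rw [map_prod, toAdd_prod, Finset.mul_sum]
    refine Finset.sum_congr rfl fun k _ => ?_
    rw [PrimeCoord.toAdd_coordGp_realSMul, hm k, map_div, map_div, toAdd_div, hco, hco]
    simp only [A]
    push_cast
    ring
  -- S3: effectivity of `b` ⇒ the RATIONAL inequalities `0 ≤ Σ_k A 𝔮 k · r k`
  have hbx' : (∏ k, IsPerfFactorial.Rlf.realSMul (hpf (op Y)) (r k) (ιg (dm.div₀ (op Y) (g k)))) =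
      Algebra.GrothendieckGroup.of x := (hP r).symm.trans hbx
  have hr : ∀ 𝔮, 0 ≤ ∑ k, (A 𝔮 k : ℝ) * r k := by
    intro 𝔮
    have h0 : 0 ≤ (cst 𝔮 : ℝ) * ∑ k, (A 𝔮 k : ℝ) * r k := by
      rw [← hL 𝔮 r, hbx']
      exact PrimeCoord.coordGp_of_nonneg 𝔮 (f 𝔮) x
    exact (mul_nonneg_iff_of_pos_left (NNReal.coe_pos.mpr (pos_iff_ne_zero.mpr (hcst0 𝔮)))).mp h0
  -- S4: `r` is a real combination of RATIONAL solutions (rational polyhedral cone)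
  have hspan := Literature.Analysis.Convex.RationalCone.mem_span_ratCast_of_forall_sum_mul_nonneg
    (J := Primes (Perfection (dm.Φ₀.obj (op Y)))) A r hr
  -- S5: `ℝ·Φ₀^cnst` is stable under real combinations; reduce to rational solutions
  clear hb hbx hbx' hr
  induction hspan using Submodule.span_induction with
  | zero =>
    simp only [Pi.zero_apply, RealificationData.rsmul_zero, Finset.prod_const_one]
    exact Subgroup.one_mem _
  | add v v' _ _ hv hv' =>
    simp only [Pi.add_apply, RealificationData.rsmul_add, Finset.prod_mul_distrib]
    exact Subgroup.mul_mem _ hv hv'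
  | smul s v _ hv =>
    have hs : (∏ k, (realData dm hpf).rsmul Y ((s • v) k) ((realData dm hpf).toRlfGp Y (dm.div₀ (op Y) (g k)))) =
        (realData dm hpf).rsmul Y s
          (∏ k, (realData dm hpf).rsmul Y (v k) ((realData dm hpf).toRlfGp Y (dm.div₀ (op Y) (g k)))) := by
      rw [map_prod]
      exact Finset.prod_congr rfl fun k _ => by rw [Pi.smul_apply, smul_eq_mul, RealificationData.rsmul_mul]
    rw [hs]
    exact RealificationDataLemmas.rsmul_mem_realSpan (realData dm hpf) dm.cnstGp Y s hv
  | mem v hv =>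
    -- S6: a rational solution `q = z / N` gives the function `g_q := ∏ g_k^{z k}` with EFFECTIVE divisor
    obtain ⟨q, hq, rfl⟩ := hv
    obtain ⟨N, hN, z, hz⟩ := exists_int_eq_nat_mul q
    have hzq : ∀ k, (z k : ℝ) = (N : ℝ) * (q k : ℝ) := fun k => by exact_mod_cast hz k
    let uu : Fin n → (dm.B₀.obj (op Y))ˣ := fun k => (dm.isUnit_B₀ _ (g k)).unit
    let gq : dm.B₀.obj (op Y) := ((∏ k, uu k ^ z k : (dm.B₀.obj (op Y))ˣ) : dm.B₀.obj (op Y))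
    have hdiv : dm.div₀ (op Y) gq = ∏ k, dm.div₀ (op Y) (g k) ^ z k := by
      change ((dm.div₀ (op Y)).comp (Units.coeHom _)) (∏ k, uu k ^ z k) = _
      rw [map_prod]
      exact Finset.prod_congr rfl fun k _ => by rw [map_zpow]; rfl
    -- `ι(div₀ g_q) = ∏_k z_k • ι(div₀ g_k)` (in both homes)
    have hT : (realData dm hpf).toRlfGp Y (dm.div₀ (op Y) gq) =
        ∏ k, (realData dm hpf).rsmul Y ((z k : ℝ)) ((realData dm hpf).toRlfGp Y (dm.div₀ (op Y) (g k))) := by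
      rw [hdiv, map_prod]
      exact Finset.prod_congr rfl fun k _ => by rw [map_zpow, rsmul_intCast]
    have hT' : ιg (dm.div₀ (op Y) gq) =
        ∏ k, IsPerfFactorial.Rlf.realSMul (hpf (op Y)) (z k : ℝ) (ιg (dm.div₀ (op Y) (g k))) :=
      hT.trans (hP fun k => (z k : ℝ))
    -- its coordinates are `cst 𝔮 · N · Σ_k A 𝔮 k q k ≥ 0`, so it is effective in `Φ₀^rlf`, hence in `Φ₀`
    have hpos : ∀ 𝔮, 0 ≤ Multiplicative.toAdd (PrimeCoord.coordGp (hpf (op Y)) 𝔮 (f 𝔮) (ιg (dm.div₀ (op Y) gq))) := by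
      intro 𝔮
      have hq' : (0 : ℝ) ≤ ∑ k, (A 𝔮 k : ℝ) * (q k : ℝ) := by exact_mod_cast hq 𝔮
      have hsum : ∑ k, (A 𝔮 k : ℝ) * (z k : ℝ) = (N : ℝ) * ∑ k, (A 𝔮 k : ℝ) * (q k : ℝ) := by
        rw [Finset.mul_sum]
        exact Finset.sum_congr rfl fun k _ => by rw [hzq]; ring
      rw [hT', hL, hsum]
      exact mul_nonneg (NNReal.coe_nonneg _) (mul_nonneg (Nat.cast_nonneg _) hq')
    obtain ⟨y, hy⟩ := PrimeCoord.exists_eq_of_of_coordGp_nonneg f (ιg (dm.div₀ (op Y) gq)) hpos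
    obtain ⟨x₀, hx₀, -⟩ := RlfEffective.exists_eq_of (hpf (op Y)) (dm.div₀ (op Y) gq) y (by rw [← hy, hιg]; rfl)
    -- hence `g_q ∈ F₀(Y)` (Prop 3.4 (ii)) and `div₀ g_q ∈ Φ₀^cnst`
    have hcn : dm.div₀ (op Y) gq ∈ dm.cnstGp.carrier Y :=
      dm.mem_cnstGp_of_mem_cnst Y ⟨gq, h34.mem_F₀_of_div₀_mem (op Y) gq x₀ hx₀, rfl⟩
    -- and `∏_k q_k • ι(div₀ g_k) = (1/N) • ι(div₀ g_q) ∈ ℝ·Φ₀^cnst`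
    have hLq : (∏ k, (realData dm hpf).rsmul Y ((q k : ℚ) : ℝ)
        ((realData dm hpf).toRlfGp Y (dm.div₀ (op Y) (g k)))) =
          (realData dm hpf).rsmul Y ((N : ℝ)⁻¹) ((realData dm hpf).toRlfGp Y (dm.div₀ (op Y) gq)) := by
      rw [hT, map_prod]
      refine Finset.prod_congr rfl fun k _ => ?_
      rw [← RealificationData.rsmul_mul, hzq, ← mul_assoc, inv_mul_cancel₀ (Nat.cast_ne_zero.mpr hN.ne'), one_mul]
    rw [hLq]
    exact Subgroup.subset_closure ⟨(N : ℝ)⁻¹, dm.div₀ (op Y) gq, hcn, rfl⟩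

/-- **`Prop34Cnst (ofRlfR dm hpf) cnst` — all four clauses — from the `B₀`-level Prop. 3.4 (ii) and its naturality
clauses, when EVERY `Φ₀(Y)` has finitely many primes, all `ℚ`-primes** (print's situation for coverings with finitely
many irreducible components, Remark 3.3.1). [cite: MochizukiEtTh2009, Prop 3.4 (ii) p.74] -/
theorem ofRlfR_of_finite_ratPrimes (h34 : dm.Prop34 V V₀) (h₀ : dm.Prop34Cnst₀ cnst)
    (hfin : ∀ Y : D₀, Finite (Primes (Perfection (dm.Φ₀.obj (op Y)))))
    (hQ : ∀ (Y : D₀) (𝔮 : Primes (Perfection (dm.Φ₀.obj (op Y)))), IsQMonoprime (PfAt (dm.Φ₀.obj (op Y)) 𝔮)) :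
    (ofRlfR dm hpf).Prop34Cnst cnst :=
  ofRlfR_of_eff h₀ fun Y b x hb hbx =>
    haveI := hfin Y
    eff_of_finite_ratPrimes h34 Y (hQ Y) b x hb hbx

end RealifiedDivisorMonoids.Prop34Cnst

/-! ### Theorem 3.7 (iii) over the constructed `Λ = ℝ` data, finitely many `ℚ`-primes -/

namespace TemperedFrobenioid

variable {D₀ : Type u} [Category.{v} D₀] {dm : DivisorMonoids.{u, v, w} D₀}
  {hpf : ∀ Y : D₀ᵒᵖ, IsPerfFactorial (dm.Φ₀.obj Y)} {V : FrdIMonoidStub.{w}} {V₀ : FrdICatStub.{u, v, w} D₀}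
  {D : Type u₀} [Category.{v₀} D] {VD : FrdICatStub.{u₀, v₀, w} D}
  (C₀ : TemperedFrobenioid (RealifiedDivisorMonoids.ofRlfR dm hpf) D VD)
  {Dcnst : Type u₁} [Category.{v₁} Dcnst] {cnst : D₀ ⥤ Dcnst}

/-- **Theorem 3.7 (iii) for a tempered Frobenioid of monoid type `ℝ` over the CONSTRUCTED data `ofRlfR dm hpf`**, at
the instantiated facade, modulo ONLY the `B₀`-level statements `dm.Prop34` and `dm.Prop34Cnst₀ cnst`, when every
`Φ₀(Y)` has finitely many primes, all `ℚ`-primes. [cite: MochizukiEtTh2009, Thm 3.7 (iii) p.79] -/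
theorem thm37_iii_withCnst_ofRlfR_fin (F : FrobenioidFacade.{u₀, v₀, w} D) (h34 : dm.Prop34 V V₀)
    (h₀ : dm.Prop34Cnst₀ cnst) (hfin : ∀ Y : D₀, Finite (Primes (Perfection (dm.Φ₀.obj (op Y)))))
    (hQ : ∀ (Y : D₀) (𝔮 : Primes (Perfection (dm.Φ₀.obj (op Y)))), IsQMonoprime (PfAt (dm.Φ₀.obj (op Y)) 𝔮)) :
    C₀.Thm37_iii (F.withCnst (C₀.base ⋙ cnst)) :=
  C₀.thm37_iii_withCnst F (RealifiedDivisorMonoids.Prop34Cnst.ofRlfR_of_finite_ratPrimes h34 h₀ hfin hQ)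

end TemperedFrobenioid

/-! ### v2 (append-only): the hypothesis in print's form — finitely many primes of `Φ₀(Y)`, each `M_𝔭 ≅ ℤ_{≥0}`
(or `ℚ_{≥0}`) — via `Prime(M) ≅ Prime(M^pf)` and `M^pf_𝔮 ≅ (M_𝔭)^pf` -/

namespace RealifiedDivisorMonoids.Prop34Cnst

variable {D₀ : Type u} [Category.{v} D₀] {dm : DivisorMonoids.{u, v, w} D₀}
  {hpf : ∀ Y : D₀ᵒᵖ, IsPerfFactorial (dm.Φ₀.obj Y)} {V : FrdIMonoidStub.{w}} {V₀ : FrdICatStub.{u, v, w} D₀}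
  {Dcnst : Type u₁} [Category.{v₁} Dcnst] {cnst : D₀ ⥤ Dcnst}

/-- For a sharp monoid whose every `M_𝔭` is `ℤ`- or `ℚ`-monoprime, every `M^pf_𝔮` is `ℚ`-monoprime
(`M^pf_𝔮 ≅ (M_𝔭)^pf`, [FrdI] §0 p.12, and `(ℤ_{≥0})^pf ≅ ℚ_{≥0}`). [cite: MochizukiFrdI2008, §0 p.12] -/
theorem isQMonoprime_pfAt_of_forall {M : Type w} [CommMonoid M] (hM : IsSharp M)
    (hZQ : ∀ 𝔭 : Primes M, IsZMonoprime ↥𝔭.submonoid ∨ IsQMonoprime ↥𝔭.submonoid)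
    (𝔮 : Primes (Perfection M)) : IsQMonoprime (PfAt M 𝔮) := by
  obtain ⟨𝔭, ⟨e⟩⟩ := PerfectionPrimes.pfAt_mulEquiv hM 𝔮
  obtain ⟨⟨e'⟩⟩ : IsQMonoprime (Perfection ↥𝔭.submonoid) :=
    (hZQ 𝔭).elim IsZMonoprime.perfection IsQMonoprime.perfection
  exact ⟨⟨e.trans e'⟩⟩

/-- For a sharp monoid, `Prime(M^pf)` is finite when `Prime(M)` is (`Prime(M) ≅ Prime(M^pf)`, [FrdI] §0 p.12).
[cite: MochizukiFrdI2008, §0 p.12] -/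
theorem finite_primes_perfection {M : Type w} [CommMonoid M] (hM : IsSharp M) [Finite (Primes M)] :
    Finite (Primes (Perfection M)) := by
  obtain ⟨e, -⟩ := primes_equiv_primes_perfection hM
  exact Finite.of_equiv _ e

/-- **The `Λ = ℝ` effective-locus clause in print's setting**: `Φ₀(Y)` has finitely many primes and every
`Φ₀(Y)_𝔭` is `ℤ`-monoprime (or `ℚ`-monoprime) — the situation of [EtTh] Remark 3.3.1 / Prop. 3.4 for a covering
with finitely many irreducible components (primes = orbits of prime log-divisors, `ℤ`-valued).
[cite: MochizukiEtTh2009, Prop 3.4 (ii) p.74] -/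
theorem eff_of_finite_intPrimes (h34 : dm.Prop34 V V₀) (Y : D₀) [Finite (Primes (dm.Φ₀.obj (op Y)))]
    (hZQ : ∀ 𝔭 : Primes (dm.Φ₀.obj (op Y)), IsZMonoprime ↥𝔭.submonoid ∨ IsQMonoprime ↥𝔭.submonoid)
    (b : Algebra.GrothendieckGroup ((realData dm hpf).rlf.obj (op Y))) (x : (hpf (op Y)).Rlf)
    (hb : b ∈ ((realData dm hpf).realSpan dm.biratGp).carrier Y) (hbx : b = Algebra.GrothendieckGroup.of x) :
    b ∈ ((realData dm hpf).realSpan dm.cnstGp).carrier Y :=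
  haveI := finite_primes_perfection (hpf (op Y)).isDivisorial.isSharp
  eff_of_finite_ratPrimes h34 Y (isQMonoprime_pfAt_of_forall (hpf (op Y)).isDivisorial.isSharp hZQ) b x hb hbx

/-- **`Prop34Cnst (ofRlfR dm hpf) cnst` from `Prop34`, `Prop34Cnst₀` and print's finiteness / `ℤ`-primes setting at
every `Y`.** [cite: MochizukiEtTh2009, Prop 3.4 (ii) p.74] -/
theorem ofRlfR_of_finite_intPrimes (h34 : dm.Prop34 V V₀) (h₀ : dm.Prop34Cnst₀ cnst)
    (hfin : ∀ Y : D₀, Finite (Primes (dm.Φ₀.obj (op Y))))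
    (hZQ : ∀ (Y : D₀) (𝔭 : Primes (dm.Φ₀.obj (op Y))), IsZMonoprime ↥𝔭.submonoid ∨ IsQMonoprime ↥𝔭.submonoid) :
    (ofRlfR dm hpf).Prop34Cnst cnst :=
  ofRlfR_of_eff h₀ fun Y b x hb hbx =>
    haveI := hfin Y
    eff_of_finite_intPrimes h34 Y (hZQ Y) b x hb hbx

end RealifiedDivisorMonoids.Prop34Cnst

namespace TemperedFrobenioid

variable {D₀ : Type u} [Category.{v} D₀] {dm : DivisorMonoids.{u, v, w} D₀}
  {hpf : ∀ Y : D₀ᵒᵖ, IsPerfFactorial (dm.Φ₀.obj Y)} {V : FrdIMonoidStub.{w}} {V₀ : FrdICatStub.{u, v, w} D₀}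
  {D : Type u₀} [Category.{v₀} D] {VD : FrdICatStub.{u₀, v₀, w} D}
  (C₀ : TemperedFrobenioid (RealifiedDivisorMonoids.ofRlfR dm hpf) D VD)
  {Dcnst : Type u₁} [Category.{v₁} Dcnst] {cnst : D₀ ⥤ Dcnst}

/-- **Theorem 3.7 (iii), `Λ = ℝ`, over the constructed data, in print's setting** (finitely many primes of every
`Φ₀(Y)`, each `Φ₀(Y)_𝔭 ≅ ℤ_{≥0}` or `ℚ_{≥0}`), modulo only `dm.Prop34` and `dm.Prop34Cnst₀ cnst`.
[cite: MochizukiEtTh2009, Thm 3.7 (iii) p.79] -/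
theorem thm37_iii_withCnst_ofRlfR_fin' (F : FrobenioidFacade.{u₀, v₀, w} D) (h34 : dm.Prop34 V V₀)
    (h₀ : dm.Prop34Cnst₀ cnst) (hfin : ∀ Y : D₀, Finite (Primes (dm.Φ₀.obj (op Y))))
    (hZQ : ∀ (Y : D₀) (𝔭 : Primes (dm.Φ₀.obj (op Y))), IsZMonoprime ↥𝔭.submonoid ∨ IsQMonoprime ↥𝔭.submonoid) :
    C₀.Thm37_iii (F.withCnst (C₀.base ⋙ cnst)) :=
  C₀.thm37_iii_withCnst F (RealifiedDivisorMonoids.Prop34Cnst.ofRlfR_of_finite_intPrimes h34 h₀ hfin hZQ)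

end TemperedFrobenioid

end Literature.AnabelianGeometry.EtaleTheta

end
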